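import Mathlib
import HarnessLib
import Literature.Analysis.FluidPDE.SpaceTimeRescaling
import Literature.Analysis.FluidPDE.SuitableWeak

/-!
# Route `AxisTwistDoor`, crux `AveragedConeLiouville` (stmt-NavierStokesRegularity-26889) — toward replacing the
# Lei–Ren input (programme R2), piece S5‴: UN-ZOOMING A SMOOTH BOUNDED REPRESENTATIVE TO POINTWISE BOUNDS

Piece S5″ (`…SmoothRep.exists_smooth_rep_of_small`) gives, for the ZOOMED velocity `V = s • stPull (s²) s z.1 z.2 v`
(`V(τ, y) = s · v(z.1 + s²τ, z.2 + s y)`), a representative `W` on `Q(0, 1/2)` with `‖W‖ ≤ c₀`, `‖∇_y W‖ ≤ c₁`.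
For a velocity `v` that is CONTINUOUS on `Q(z, s)` (the route's class profiles are smooth below the apex time) the
a.e. equality upgrades to equality on the open cylinder, and un-zooming gives POINTWISE bounds on `Q(z, s/2)`:

* `pointwise_bounds_of_smooth_rep` — `‖v(t, x)‖ ≤ c₀ / s` and `‖∇ₓ v(t, ·)(x)‖ ≤ c₁ / s²` for every
  `(t, x) ∈ Q(z, s/2)`.

Pure calculus (no Navier–Stokes content).  Seat ns-atd-p1 (LEAD g2).  WHAT THIS IS NOT: not a statement about
Navier–Stokes regularity.  Lands `--supports` the crux item as a helper.
-/

noncomputable section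

set_option linter.dupNamespace false

namespace Summit.NavierStokesRegularity.NavierStokesRegularity.Theorems.AveragedConeLiouville.Unzoom

open scoped ENNReal NNReal Topology
open Set Function MeasureTheory Metric Filter TopologicalSpace
open Literature.Analysis.FluidPDE

/-- The zoom map `(t, x) ↦ ((t − z.1)/s², (x − z.2)/s)` sends `Q(z, s/2)` into `Q(0, 1/2)`. -/
theorem zoom_mem {z : ℝ × EuclideanSpace ℝ (Fin 3)} {s : ℝ} (hs : 0 < s) {w : ℝ × EuclideanSpace ℝ (Fin 3)}
    (hw : w ∈ parabolicCylinder (s / 2) z) :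
    (((w.1 - z.1) / s ^ 2, s⁻¹ • (w.2 - z.2)) : ℝ × EuclideanSpace ℝ (Fin 3)) ∈
      parabolicCylinder (1 / 2) (0 : ℝ × EuclideanSpace ℝ (Fin 3)) := by
  rw [mem_parabolicCylinder] at hw ⊢
  obtain ⟨⟨h1, h2⟩, h3⟩ := hw
  have hs2 : 0 < s ^ 2 := by positivity
  simp only [Prod.fst_zero, Prod.snd_zero, dist_zero_right]
  refine ⟨⟨?_, ?_⟩, ?_⟩
  · rw [lt_div_iff₀ hs2]; nlinarith
  · rw [div_lt_iff₀ hs2]; linarith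
  · rw [norm_smul, norm_inv, Real.norm_of_nonneg hs.le, ← dist_eq_norm]
    rw [inv_mul_lt_iff₀ hs]; linarith

/-- **Un-zooming a smooth bounded representative.**  If `v` is continuous on `Q(z, s)`,
the zoomed velocity `s • stPull (s²) s z.1 z.2 v` agrees a.e. on `Q(0, 1/2)` with `W`, continuous on `Q(0, 1/2)` with
`C¹` slices, `‖W‖ ≤ c₀` and `‖iteratedFDeriv 1 (W τ) y‖ ≤ c₁` there, then `‖v(t,x)‖ ≤ c₀/s` and
`‖fderiv (v t) x‖ ≤ c₁/s²` on `Q(z, s/2)`. -/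
theorem pointwise_bounds_of_smooth_rep {v W : ℝ → EuclideanSpace ℝ (Fin 3) → EuclideanSpace ℝ (Fin 3)}
    {z : ℝ × EuclideanSpace ℝ (Fin 3)} {s c₀ c₁ : ℝ} (hs : 0 < s)
    (hvc : ContinuousOn (uncurry v) (parabolicCylinder s z))
    (hae : uncurry (s • stPull (s ^ 2) s z.1 z.2 v) =ᵐ[volume.restrict
      (parabolicCylinder (1 / 2) (0 : ℝ × EuclideanSpace ℝ (Fin 3)))] uncurry W)
    (hWc : ContinuousOn (uncurry W) (parabolicCylinder (1 / 2) (0 : ℝ × EuclideanSpace ℝ (Fin 3))))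
    (hWd : ∀ w ∈ parabolicCylinder (1 / 2) (0 : ℝ × EuclideanSpace ℝ (Fin 3)), DifferentiableAt ℝ (W w.1) w.2)
    (h0 : ∀ w ∈ parabolicCylinder (1 / 2) (0 : ℝ × EuclideanSpace ℝ (Fin 3)), ‖W w.1 w.2‖ ≤ c₀)
    (h1 : ∀ w ∈ parabolicCylinder (1 / 2) (0 : ℝ × EuclideanSpace ℝ (Fin 3)), ‖iteratedFDeriv ℝ 1 (W w.1) w.2‖ ≤ c₁) :
    ∀ w ∈ parabolicCylinder (s / 2) z, ‖v w.1 w.2‖ ≤ c₀ / s ∧ ‖fderiv ℝ (v w.1) w.2‖ ≤ c₁ / s ^ 2 := by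
  have hs2 : 0 < s ^ 2 := by positivity
  set Q₀ : Set (ℝ × EuclideanSpace ℝ (Fin 3)) := parabolicCylinder (1 / 2) (0 : ℝ × EuclideanSpace ℝ (Fin 3)) with hQ₀
  have hQ₀o : IsOpen Q₀ := isOpen_parabolicCylinder _ _
  -- the zoom maps `Q(0, 1/2)` into `Q(z, s/2) ⊆ Q(z, s)`
  have hmaps : ∀ q ∈ Q₀, ((z.1 + s ^ 2 * q.1, z.2 + s • q.2) : ℝ × EuclideanSpace ℝ (Fin 3)) ∈ parabolicCylinder s z := by
    rintro ⟨τ, y⟩ hq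
    rw [hQ₀, mem_parabolicCylinder] at hq
    rw [mem_parabolicCylinder]
    obtain ⟨⟨hq1, hq2⟩, hq3⟩ := hq
    simp only [Prod.fst_zero, Prod.snd_zero, dist_zero_right] at hq1 hq2 hq3 ⊢
    refine ⟨⟨by nlinarith, by nlinarith⟩, ?_⟩
    rw [dist_eq_norm, add_sub_cancel_left, norm_smul, Real.norm_of_nonneg hs.le]
    nlinarith
  -- continuity of the zoomed velocity on `Q(0, 1/2)`
  have hVc : ContinuousOn (uncurry (s • stPull (s ^ 2) s z.1 z.2 v)) Q₀ := by
    have hφ : Continuous fun q : ℝ × EuclideanSpace ℝ (Fin 3) =>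
        ((z.1 + s ^ 2 * q.1, z.2 + s • q.2) : ℝ × EuclideanSpace ℝ (Fin 3)) := by fun_prop
    have h := (hvc.comp hφ.continuousOn hmaps).const_smul s
    refine h.congr fun q _ => ?_
    simp [stPull, uncurry]
  -- equality everywhere on the open cylinder
  have heq : EqOn (uncurry (s • stPull (s ^ 2) s z.1 z.2 v)) (uncurry W) Q₀ :=
    Measure.eqOn_open_of_ae_eq hae hQ₀o hVc hWc
  intro w hw
  -- the zoomed point
  obtain ⟨τ, hτ⟩ : ∃ τ : ℝ, τ = (w.1 - z.1) / s ^ 2 := ⟨_, rfl⟩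
  obtain ⟨y, hy⟩ : ∃ y : EuclideanSpace ℝ (Fin 3), y = s⁻¹ • (w.2 - z.2) := ⟨_, rfl⟩
  have hq : ((τ, y) : ℝ × EuclideanSpace ℝ (Fin 3)) ∈ Q₀ := by rw [hτ, hy]; exact zoom_mem hs hw
  have hback1 : z.1 + s ^ 2 * τ = w.1 := by rw [hτ]; field_simp; ring
  have hback2 : ∀ y' : EuclideanSpace ℝ (Fin 3), z.2 + s • (s⁻¹ • (y' - z.2)) = y' := fun y' => by
    rw [smul_smul, mul_inv_cancel₀ hs.ne', one_smul, add_sub_cancel]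
  -- value bound
  have hval : s • v w.1 w.2 = W τ y := by
    have := heq hq
    simp only [uncurry, Pi.smul_apply, stPull] at this
    rw [hback1] at this
    rw [hy, hback2] at this
    rw [hy]; exact this
  refine ⟨?_, ?_⟩
  · have h := h0 _ hq
    rw [← hval, norm_smul, Real.norm_of_nonneg hs.le] at h
    rw [le_div_iff₀ hs]; linarith
  · -- the slice `v w.1` near `w.2` is `x ↦ s⁻¹ • W τ (s⁻¹ • (x − z.2))`
    have hslice : ∀ᶠ x in 𝓝 w.2, v w.1 x = s⁻¹ • W τ (s⁻¹ • (x - z.2)) := by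
      -- points `x` near `w.2` zoom into `Q₀` at the same time `τ`
      have hcont : ContinuousAt (fun x : EuclideanSpace ℝ (Fin 3) => ((τ, s⁻¹ • (x - z.2)) : ℝ × EuclideanSpace ℝ (Fin 3))) w.2 := by
        fun_prop
      have hev : ∀ᶠ x in 𝓝 w.2, ((τ, s⁻¹ • (x - z.2)) : ℝ × EuclideanSpace ℝ (Fin 3)) ∈ Q₀ :=
        hcont.preimage_mem_nhds (hQ₀o.mem_nhds (by simpa [hy] using hq))
      filter_upwards [hev] with x hx
      have := heq hx
      simp only [uncurry, Pi.smul_apply, stPull] at this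
      rw [hback1, hback2] at this
      -- `s • v w.1 x = W τ (s⁻¹ • (x − z.2))`
      rw [← this, smul_smul, inv_mul_cancel₀ hs.ne', one_smul]
    have hWy : DifferentiableAt ℝ (W τ) y := hWd _ hq
    -- derivative of the affine zoom and of the composite
    set A : EuclideanSpace ℝ (Fin 3) →L[ℝ] EuclideanSpace ℝ (Fin 3) :=
      s⁻¹ • ContinuousLinearMap.id ℝ (EuclideanSpace ℝ (Fin 3)) with hA
    set L : EuclideanSpace ℝ (Fin 3) →L[ℝ] EuclideanSpace ℝ (Fin 3) := fderiv ℝ (W τ) y with hL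
    have hinner : HasFDerivAt (fun x : EuclideanSpace ℝ (Fin 3) => s⁻¹ • (x - z.2)) A w.2 :=
      ((hasFDerivAt_id w.2).sub_const z.2).const_smul s⁻¹
    have h2 : HasFDerivAt (W τ) L (s⁻¹ • (w.2 - z.2)) := by rw [hL, ← hy]; exact hWy.hasFDerivAt
    have hcomp : HasFDerivAt (fun x : EuclideanSpace ℝ (Fin 3) => s⁻¹ • W τ (s⁻¹ • (x - z.2)))
        (s⁻¹ • (L.comp A)) w.2 := (h2.comp w.2 hinner).const_smul s⁻¹
    have hfd : fderiv ℝ (v w.1) w.2 = s⁻¹ • (L.comp A) := by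
      rw [Filter.EventuallyEq.fderiv_eq hslice]
      exact hcomp.fderiv
    have hn1 : ‖L‖ ≤ c₁ := by
      have h := h1 _ hq
      rw [norm_iteratedFDeriv_one] at h
      simpa only [hL] using h
    have hn2 : ‖A‖ ≤ s⁻¹ := by
      rw [hA, norm_smul, norm_inv, Real.norm_of_nonneg hs.le]
      exact mul_le_of_le_one_right (by positivity) ContinuousLinearMap.norm_id_le
    have hc1 : 0 ≤ c₁ := (norm_nonneg _).trans hn1
    have hop : ‖L.comp A‖ ≤ c₁ * s⁻¹ := by
      have h3 : ‖L.comp A‖ ≤ ‖L‖ * ‖A‖ := ContinuousLinearMap.opNorm_comp_le L A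
      have h4 : ‖L‖ * ‖A‖ ≤ c₁ * s⁻¹ := mul_le_mul hn1 hn2 (norm_nonneg _) hc1
      exact h3.trans h4
    rw [hfd, norm_smul, norm_inv, Real.norm_of_nonneg hs.le]
    calc s⁻¹ * ‖L.comp A‖ ≤ s⁻¹ * (c₁ * s⁻¹) := mul_le_mul_of_nonneg_left hop (by positivity)
      _ = c₁ / s ^ 2 := by rw [div_eq_mul_inv, sq, mul_inv]; ring

end Summit.NavierStokesRegularity.NavierStokesRegularity.Theorems.AveragedConeLiouville.Unzoom

end
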